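import Literature.MathematicalPhysics.QuantumFieldTheory.Balaban1983to89.NodeOLettersOfWalksAcross
import Literature.MathematicalPhysics.QuantumFieldTheory.Balaban1983to89.NodeOLettersOfWalksWitnessSym

/-!
# `Balaban1983to89.NodeOLettersOfWalksAcrossWitness` — NODE O's binder `ExistsUniformAcrossSmall` (B13TermWalkDataOneTorus :353)
# INHABITED, NON-VACUOUSLY, BY THE SYMMETRIC MODEL FAMILY ON ALL TORI with ONE sixteen-constant W-walks package
# (`UniformWalksAcross (modelFamily …) (qModel … η)` ⟹ `acrossSmall_of_walks_std`)

statement-level bookkeeping over published theorems with citation tags; finite-matrix MODELS on the unit tori, kernel-checked;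
nothing here is a claim about the Yang–Mills mass gap.

Cell `pub-ymgap`, D-0062 Track A, node N10 = [Balaban1988RG2Cluster] Lemmas 1–3; seat `dag-n10-b` g5.  WHY.  `NodeOLettersOfWalksAcross`
(p443891) typed the (B1) input of record ACROSS a family — `UniformWalksAcross 𝓣 q` — and derived NODE O's binder of record
`ExistsUniformAcrossSmall 𝓣 α R_σ0 θ₀` from it by name (`acrossSmall_of_walks`, `…_std`); the cell's discharge referee (READ-338 (A2))
noted that both are VACUOUS on a family whose members have no terms, and asked for the non-vacuous inhabitant; `NodeOLettersOfWalksWitnessSym`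
(p446093) supplies, on ONE torus, the non-collapsing SYMMETRIC model term (WITNESS 3).  This leaf puts the two together: a genuine infinite
family (every torus size, every non-empty σ-region, one symmetric model term each) carrying ONE package, and NODE O's binder for it.
* §1 `qModel` — THE package (WITNESS 3's sixteen constants: `R`; `(2, 2, K̄_loc(λ′_t; 1, 5, ν))`; `(2, 1, μ_P + K̄_loc(λ′_{t_P}; 1, 4, 2ν))`,
  `m_P`; `(2, 2, μ_A + K̄_loc(λ′_{λ_A}; 0, ·, 1))`, `m_A`; `η`, `c_V(η)`; `c_V₀ = c_V(½)`; `R_σ = 0`) — NO field reads the torus;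
  `qModel_admissible`, `qModel_positiveRates`, **`etaMax_qModel_indep`** (`rfl`: the admissible ceiling `etaMax` reads neither `η` nor
  `c_V` — the ORDER of choices, kernel-checked on the model package).
* §2 **`termWalks_model₃`** — on every site torus and for EVERY volume rate `η > 0`, the symmetric model term carries the W-walks datum
  `TermWalks (modelKernels … (μ_P·1 + H_P^{sym}) …) (qModel … η)` (the three expansions, two accretivity constants, five volume sums,
  far-ness — WITNESS 3's proof, by name).
* §3 `ModelTorus ν` (side lengths `N_i + 1` — every positive size occurs — and a non-empty σ-region), **`modelFamily`**
  `: ModelTorus ν → B13TermWalkData.TorusTerms c d` (one symmetric model term per member, `ι = Unit`),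
  **`uniformWalksAcross_model₃ : UniformWalksAcross (modelFamily …) (qModel … η)`** (every `η > 0`), and
  **`acrossSmall_model₃ : ExistsUniformAcrossSmall (modelFamily …) α R_σ0 θ₀`** via `acrossSmall_of_walks_std` with `η := etaMax`
  chosen BEFORE `c_V := c_V(η)`; hypotheses: the torus-independent smallness `m_P, m_A > 0`; `0 ≤ α < R`;
  `R_σ0 ≤ 0`; `θ₀ ≥ 4K̄ + 4` (which also covers `α ≤ θ₀R/(4K̄+4)`) — print's far-ness source `R_σ ≥ log((4K̄+4)/θ₀)/(ρ′−κ_C)` READ AT THE MODEL's `R_σ = 0` (its σ-region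
  touches the rows, so no gain `e^{−εR_σ}` is available and the threshold is a largeness condition on `θ₀`; for Bałaban's family
  `R_σ ≍ M` does this work, p. 13).
PROVENANCE.  The memo cell `ym-nodeO-ideate` P3 g24 inhabited `UniformWalksAcross` by the WITNESS-2 model family in its evidence sketch v3
(row 54 on `stmt-QuantumFields-19181`, §6: `qModel`, `termWalks_model`, `modelFamily`, `uniformWalksAcross_model`, `acrossSmall_model`); this
leaf is the n10 lineage's own typing of that design against the LANDED modules, with WITNESS 3's SYMMETRIC precision in place of WITNESS 2's
one-directional one (READ-331's degeneracy) — same names with subscript ₃; two further deviations: members are indexed by side lengths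
`N_i + 1` (no `attribute [instance]` on a structure field), and the sketch's raw far-ness hypothesis `log((4K̄+4)/θ₀)/(μ/4 − κ_C⋆) ≤ 0` is
DISCHARGED here to its content `θ₀ ≥ 4K̄ + 4` (memo copy `ym-nodeO-ideate/memos/lines/NodeO-walks-rung-v3-P3g24.lean`, 652 l., §6).
DEDUP.  The Summit-side Gaps venue has an earlier inhabitant of the binder's shape across all tori, `Gaps.D4WalkModelAcross.acrossSmall_model`
(cell pub-balaban-gaps): a LOCAL Γ-kernel with FREE precision ∕ covariance slots (`A = 1`, `C = 1`) via `TermWalkData` directly — no (2.7)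
square root, no accretivity, no rung; not importable here (Summits ⟵̸ Literature) and not restated.  This leaf inhabits the RUNG
`UniformWalksAcross` (three expansions + two accretivity constants + the product reading) and goes through `acrossSmall_of_walks_std`.
CITATIONS.  [Balaban1988RG2Cluster] (1.11) p. 5, p. 13 (σ₀-cubes far from `Z₀`), (2.7) p. 13, p. 15, (2.14)–(2.16) pp. 15–16;
[Balaban1985BackgroundPropagators] Thm 3.10 (3.107)–(3.108) p. 416 (*"The constant O(1) depends on d and L only"*), (3.154) p. 427;
[Balaban1984PropagatorsII] Lemma 2.1 (2.61) p. 234.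
HONEST FRAMING: MODELS — they certify that NODE O's binder SHAPE `ExistsUniformAcrossSmall` and the rung `UniformWalksAcross` are inhabited
NON-VACUOUSLY by a genuine infinite family with ONE torus-independent package, and NOTHING ELSE; whether Bałaban's family carries such a
package is the in-edge's ([13] = N06 ∕ GAPS G-B9-10) and the NODE 00 pin's content, untouched.  Count-neutral Track-A side landing; NOT a
discharge of N10; NOT NODE O for Bałaban's family; nothing continuum ∕ ℝ⁴ ∕ OS ∕ mass-gap ∕ Clay.  0 `sorry`; MODEL `def`s∕`structure`
(`qModel`, `ModelTorus`, `modelFamily`) only, no instance, no notation; standard axioms.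
-/

noncomputable section

namespace Literature.MathematicalPhysics.QuantumFieldTheory.Balaban1983to89.NodeOLettersOfWalksAcrossWitness

open Metric Set Finset
open scoped Matrix
open Literature.MathematicalPhysics.QuantumFieldTheory.Balaban1983to89
open Literature.MathematicalPhysics.QuantumFieldTheory.Balaban1983to89.B9Thm37GlueTorus (tdist1 tdist1_nonneg)
open Literature.MathematicalPhysics.QuantumFieldTheory.Balaban1983to89.TreeLengthTorus (TPt)
open Literature.MathematicalPhysics.QuantumFieldTheory.Balaban1983to89.B5TorusCover (UT)
open Literature.MathematicalPhysics.QuantumFieldTheory.Balaban1983to89.B13JointWalkExpansion (JointWalkExpansion)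
open Literature.MathematicalPhysics.QuantumFieldTheory.Balaban1983to89.B13LocalKernelWalks (LocalTerms)
open Literature.MathematicalPhysics.QuantumFieldTheory.Balaban1983to89.B13TermWalkData (TermKernels TorusTerms)
open Literature.MathematicalPhysics.QuantumFieldTheory.Balaban1983to89.B13TermWalkDataOneTorus (ExistsUniformAcrossSmall)
open Literature.MathematicalPhysics.QuantumFieldTheory.Balaban1983to89.NodeOLettersOfWalksAcross
  (WalkPackage TermWalks UniformWalksAcross acrossSmall_of_walks_std)
open Literature.MathematicalPhysics.QuantumFieldTheory.Balaban1983to89.NodeOLettersOfWalksWitness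
  (hopTerms diagTerms massLocal modelKernels kbarLoc kbarLoc_nonneg kbarPrec mAcc lamEff cVat cV one_le_cVat
    one_le_c0_pow volume_two_cVat volume_id_cVat jointWalkExpansion_massLocal accretive_massLocal
    hopTerms_isLocal diagTerms_isLocal abs_lt_of_mAcc_pos)
open Literature.MathematicalPhysics.QuantumFieldTheory.Balaban1983to89.NodeOLettersOfWalksWitnessSym
  (symHop symHop_isLocal im_massSymHop_zero)
open Literature.MathematicalPhysics.QuantumFieldTheory.Balaban1983to89.B13Sqrt27Accretive (invSqrt)

variable {d N' : ℕ} {ν : ℕ}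
variable {E : Type} [NormedAddCommGroup E] [NormedSpace ℂ E]

/-! ## §1. ONE sixteen-constant package for the symmetric model — a function of `(ν, κ₁, couplings, masses, ‖ℓ‖R, η)`, never of the torus -/

section Package

/-- MODEL. **THE MODEL'S W-WALKS PACKAGE** (WITNESS 3's constants, read off `NodeOLettersOfWalksWitnessSym.termLetters_model₃`'s
proof): `R`; local factor `(ε, κ, K̄) = (2, 2, K̄_loc(λ′_t; r = 1, ρ_w = 5, n_B = ν))`; full precision
`(2, 1, μ_P + K̄_loc(λ′_{t_P}; r = 1, ρ_w = 4, n_B = 2ν))` with accretivity `m_P`; term precision `(2, 2, μ_A + K̄_loc(λ′_{λ_A}; r = 0, n_B = 1))`,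
accretivity `m_A`; volume rate `η` with constant `c_V(η) = 2c₀(1,η)^ν`; Combes–Thomas volume constant `c_V₀ = c_V(½)`; far-ness
`R_σ = 0`.  NO field reads the torus side lengths. [cite: Balaban1988RG2Cluster, p.13, p.15, (2.16) p.16; Balaban1985BackgroundPropagators, Thm 3.10 p.416] -/
def qModel (c : B13.Consts) (ℓ : E →L[ℂ] ℂ) (R t tP μP μA lamA η : ℝ) (ν : ℕ) : WalkPackage where
  R := R
  εL := 2
  kapL := 2
  KbarL := kbarLoc c (lamEff t ℓ R) 1 5 ν ν
  εP := 2
  kapP := 1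
  KbarP := kbarPrec c μP tP ℓ R 1 4 (ν + ν) ν
  m := mAcc c μP tP ℓ R 1 (ν + ν) ν
  εA := 2
  kapA := 2
  KbarA := kbarPrec c μA lamA ℓ R 0 0 1 ν
  mA := mAcc c μA lamA ℓ R 0 1 ν
  η := η
  cV := cVat η ν
  cV₀ := cVat (1 / 2) ν
  Rσ := 0

/-- `λ′ ≥ 0` for `R ≥ 0`. [folklore] -/
private theorem lamEff_nonneg (lam : ℝ) (ℓ : E →L[ℂ] ℂ) {R : ℝ} (hR : 0 ≤ R) : 0 ≤ lamEff lam ℓ R := by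
  unfold lamEff
  have : 0 ≤ ‖ℓ‖ * R := mul_nonneg (norm_nonneg _) hR
  positivity

/-- The model package is ADMISSIBLE (signs) for `R > 0`, `η > 0` and positive accretivity constants `m_P, m_A`.
[cite: Balaban1988RG2Cluster, p.15, (2.16) p.16] -/
theorem qModel_admissible (c : B13.Consts) (ℓ : E →L[ℂ] ℂ) {R : ℝ} (hR : 0 < R) (t tP : ℝ) {μP μA : ℝ} (hμP : 0 < μP)
    (hμA : 0 < μA) (lamA : ℝ) {η : ℝ} (hη : 0 < η) (hmP : 0 < mAcc c μP tP ℓ R 1 (ν + ν) ν)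
    (hmA : 0 < mAcc c μA lamA ℓ R 0 1 ν) : (qModel c ℓ R t tP μP μA lamA η ν).Admissible where
  hR := hR
  hεL := by norm_num [qModel]
  hkapL := by norm_num [qModel]
  hKbarL := kbarLoc_nonneg c (lamEff_nonneg t ℓ hR.le) 1 5 ν ν
  hεP := by norm_num [qModel]
  hkapP := by norm_num [qModel]
  hKbarP := by
    show 0 ≤ kbarPrec c μP tP ℓ R 1 4 (ν + ν) ν
    unfold kbarPrec
    exact add_nonneg hμP.le (kbarLoc_nonneg c (lamEff_nonneg tP ℓ hR.le) _ _ _ _)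
  hm := hmP
  hεA := by norm_num [qModel]
  hkapA := by norm_num [qModel]
  hKbarA := by
    show 0 ≤ kbarPrec c μA lamA ℓ R 0 0 1 ν
    unfold kbarPrec
    exact add_nonneg hμA.le (kbarLoc_nonneg c (lamEff_nonneg lamA ℓ hR.le) _ _ _ _)
  hmA := hmA
  hη := hη.le
  hcV := (zero_le_one.trans (one_le_cVat hη) : (0 : ℝ) ≤ cVat η ν)
  hcV₀ := (zero_le_one.trans (one_le_cVat (by norm_num)) : (0 : ℝ) ≤ cVat (1 / 2) ν)

/-- The model package has POSITIVE input rates (`(κ_L, ε_L, ε_P, κ_A, ε_A) = (2, 2, 2, 2, 2)`).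
[cite: Balaban1985BackgroundPropagators, Thm 3.10 p.416] -/
theorem qModel_positiveRates (c : B13.Consts) (ℓ : E →L[ℂ] ℂ) (R t tP μP μA lamA η : ℝ) :
    (qModel c ℓ R t tP μP μA lamA η ν).PositiveRates where
  hkapL := by norm_num [qModel]
  hεL := by norm_num [qModel]
  hεP := by norm_num [qModel]
  hkapA := by norm_num [qModel]
  hεA := by norm_num [qModel]

/-- **THE ORDER OF CHOICES, kernel-checked**: the admissible ceiling `etaMax` of the model package does NOT read the fields
`(η, c_V)` — it is the same real number for every `η` (`rfl`). [cite: Balaban1988RG2Cluster, (2.16) p.16] -/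
theorem etaMax_qModel_indep (c : B13.Consts) (ℓ : E →L[ℂ] ℂ) (R t tP μP μA lamA η η' : ℝ) :
    (qModel c ℓ R t tP μP μA lamA η ν).etaMax = (qModel c ℓ R t tP μP μA lamA η' ν).etaMax := rfl

end Package

/-! ## §2. The W-walks datum of the symmetric model term, for EVERY volume rate `η > 0` -/

section Datum

omit [NormedSpace ℂ E] in
/-- The identity locator has fibres of size `≤ 1`. [folklore] -/
private theorem hfib_id {Nf : Fin ν → ℕ} (z : UT Nf) : (Finset.univ.filter fun b : UT Nf => id b = z).card ≤ 1 := by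
  rw [show (Finset.univ.filter fun b : UT Nf => id b = z) = {z} by ext i; simp]
  simp

/-- **THE SYMMETRIC MODEL TERM CARRIES A W-WALKS DATUM WITH THE PACKAGE `qModel … η` FOR EVERY `η > 0`** on every site
torus: `TermWalks (modelKernels … (μ_P·1 + H_P^{sym}) …) (qModel … η)` — the product reading `G2 = L·P^{−1/2}` by `rfl`, the three
joint walk expansions (`jointWalkExpansion_local_c0` ∕ `jointWalkExpansion_massLocal` with `symHop_isLocal`, `diagTerms_isLocal`),
the two accretivity constants (`accretive_massLocal`), the five volume sums at rate `η` and the Combes–Thomas one at rate `½`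
(`volume_two_cVat`, `volume_id_cVat`), far-ness `R_σ = 0`.  Hypotheses: `κ₁ ≥ 0`, `X ≠ ∅`, `R > 0`, `μ_P, μ_A > 0`, `m_A > 0`
(for `|λ_A| < μ_A` in the record; the DATUM needs no `m_P > 0` — that is the package's admissibility), `η > 0`.  NOTHING about Bałaban's kernels. [cite: Balaban1988RG2Cluster, (2.7) p.13, p.15, (2.14)–(2.16) pp.15–16; Balaban1985BackgroundPropagators, Thm 3.10 p.416; Balaban1984PropagatorsII, (2.61) p.234] -/
theorem termWalks_model₃ {Nf : Fin ν → ℕ} [∀ i, NeZero (Nf i)] (c : B13.Consts) (hκ₁ : 0 ≤ c.κ₁) {X : Finset (UT Nf)}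
    (hX : X.Nonempty) (j₀ : TPt d N') (ℓ : E →L[ℂ] ℂ) {R : ℝ} (hR : 0 < R) (t : ℝ) {μP : ℝ} (tP : ℝ) {μA lamA : ℝ} (hμP : 0 < μP)
    (hμA : 0 < μA) (hmA : 0 < mAcc c μA lamA ℓ R 0 1 ν) {η : ℝ} (hη : 0 < η) :
    TermWalks (modelKernels (d := d) (N' := N') Nf c X j₀ ℓ t
        (massLocal Nf μP (symHop Nf tP ℓ X j₀)) (im_massSymHop_zero μP tP ℓ X j₀)
        hμA (abs_lt_of_mAcc_pos c hκ₁ ℓ hR.le le_rfl le_rfl hmA))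
      (qModel c ℓ R t tP μP μA lamA η ν) := by
  have hR0 : 0 ≤ R := hR.le
  have htP := lamEff_nonneg tP ℓ hR0
  have htA := lamEff_nonneg lamA ℓ hR0
  have hc0 := one_le_c0_pow (ν := ν) one_pos
  -- the three joint walk expansions (as in `termLetters_model₃`)
  have hJL₀ := LocalTerms.jointWalkExpansion_local_c0
    (hopTerms_isLocal (d := d) (N' := N') c (er := id) (ec := Sum.inr) (locp := id) (locn := Sum.elim id id)
      (fun _ => rfl) (fun _ => rfl) t ℓ X j₀ R) hκ₁
    (by positivity) (ρ := 5) (ε := 2) (κ := 2) (μ := 1) (by norm_num) (by norm_num) one_pos (by norm_num)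
  have hJL : JointWalkExpansion c id (Sum.elim id id) (hopTerms (d := d) (N' := N') Nf id Sum.inr t ℓ X j₀).kernel X R 2 2
      (kbarLoc c (lamEff t ℓ R) 1 5 ν ν) _ _ _ _ 5 :=
    hJL₀.mono le_rfl le_rfl le_rfl (by positivity) (le_of_eq (by simp [kbarLoc, lamEff]))
  have hHP := symHop_isLocal (d := d) (N' := N') (Nf := Nf) c tP ℓ X j₀ R
  have hJP₀ := jointWalkExpansion_massLocal (d := d) (N' := N') c hκ₁ hHP htP hμP.le (kap := 1) zero_le_one
  have hJP : JointWalkExpansion c (Sum.elim id id) (Sum.elim id id)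
      (massLocal (d := d) (N' := N') Nf μP (symHop Nf tP ℓ X j₀)) X R 2 1
      (kbarPrec c μP tP ℓ R 1 4 (ν + ν) ν) _ _ _ _ (1 + 3) :=
    hJP₀.mono le_rfl le_rfl le_rfl (add_nonneg hμP.le (kbarLoc_nonneg c htP _ _ _ _))
      (le_of_eq (by simp only [kbarPrec, kbarLoc, lamEff]; norm_num))
  have hJA₀ := jointWalkExpansion_massLocal (d := d) (N' := N') c hκ₁ (diagTerms_isLocal c id hfib_id lamA ℓ X j₀ R) htA
    hμA.le (kap := 2) (by norm_num)
  have hJA : JointWalkExpansion c id id (massLocal (d := d) (N' := N') Nf μA (diagTerms Nf id lamA ℓ X j₀)) X R 2 2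
      (kbarPrec c μA lamA ℓ R 0 0 1 ν) _ _ _ _ (2 + 3) :=
    hJA₀.mono le_rfl le_rfl le_rfl (add_nonneg hμA.le (kbarLoc_nonneg c htA _ _ _ _))
      (le_of_eq (by simp [kbarPrec, kbarLoc, lamEff]))
  -- the two accretivity constants
  have hPacc := accretive_massLocal (d := d) (N' := N') c hκ₁ hHP htP
    (fun i => (volume_two_cVat (Nf := Nf) one_pos _).1) μP
  have hAacc := accretive_massLocal (d := d) (N' := N') c hκ₁ (diagTerms_isLocal c id hfib_id lamA ℓ X j₀ R) htA
    (fun i => volume_id_cVat (Nf := Nf) one_pos _) μA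
  exact
    { nonempty := hX
      product := ⟨(hopTerms (d := d) (N' := N') Nf id Sum.inr t ℓ X j₀).kernel,
        massLocal (d := d) (N' := N') Nf μP (symHop Nf tP ℓ X j₀), fun σ u => rfl, ⟨_, _, _, _, _, _, hJL⟩,
        ⟨_, _, _, _, _, _, hJP⟩, hPacc⟩
      precision := ⟨_, _, _, _, _, _, hJA⟩
      accA := hAacc
      volN₀ := fun i => (volume_two_cVat (Nf := Nf) (by show (0 : ℝ) < 1 / 2; norm_num) _).1
      volN := fun i => (volume_two_cVat (Nf := Nf) hη _).1
      volN' := fun j => (volume_two_cVat (Nf := Nf) hη _).2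
      volΛN := fun i => (volume_two_cVat (Nf := Nf) hη _).1
      volΛ := fun i => volume_id_cVat (Nf := Nf) hη _
      far := fun b z _ => tdist1_nonneg _ _ }

end Datum

/-! ## §3. THE MODEL FAMILY OVER ALL TORI and `ExistsUniformAcrossSmall` for it (NODE O's binder :353, inhabited non-vacuously) -/

section Family

/-- MODEL. A MEMBER of the model family: torus side lengths `N_i + 1` (every positive side length occurs) and a NON-EMPTY
σ-region on that torus. [cite: Balaban1988RG2Cluster, p.13] -/
structure ModelTorus (ν : ℕ) where
  N : Fin ν → ℕ
  X : Finset (UT (fun i => N i + 1))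
  hX : X.Nonempty

variable (d N')

/-- MODEL. **THE MODEL FAMILY** indexed by all tori-with-σ-region: on the member `s`, ONE term — WITNESS 3's `modelKernels` with
the SYMMETRIC hopping full precision `μ_P·1 + H_P^{sym}` on the torus of side lengths `N_i + 1` and σ-region `s.X` (the
`TorusTerms` record of `B13TermWalkData`; `ι = Unit`). [cite: Balaban1988RG2Cluster, p.13, (2.14) p.15] -/
def modelFamily (c : B13.Consts) (hκ₁ : 0 ≤ c.κ₁) (j₀ : TPt d N') (ℓ : E →L[ℂ] ℂ) {R : ℝ} (hR : 0 < R) (t μP tP : ℝ)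
    {μA lamA : ℝ} (hμA : 0 < μA) (hmA : 0 < mAcc c μA lamA ℓ R 0 1 ν) :
    ModelTorus ν → TorusTerms c d := fun s =>
  { N' := N'
    ν := ν
    Nf := fun i => s.N i + 1
    E := E
    ι := Unit
    𝒦 := fun _ => modelKernels (d := d) (N' := N') (fun i => s.N i + 1) c s.X j₀ ℓ t
      (massLocal _ μP (symHop _ tP ℓ s.X j₀)) (im_massSymHop_zero μP tP ℓ s.X j₀)
      hμA (abs_lt_of_mAcc_pos c hκ₁ ℓ hR.le le_rfl le_rfl hmA) }

variable {d N'}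

/-- **`UniformWalksAcross` FOR THE MODEL FAMILY, ONE PACKAGE FOR ALL TORI, for every volume rate `η > 0`**: every member's term
carries the W-walks datum with `qModel … η` (`termWalks_model₃` on the member's torus; the extra columns `C₀ = UT` are finite with
decidable equality — the `∃`-binders of `UniformWalksAcross`).  The smallness is the torus-INDEPENDENT `m_P, m_A > 0` only.
[cite: Balaban1988RG2Cluster, p.13, p.15; Balaban1985BackgroundPropagators, Thm 3.10 p.416] -/
theorem uniformWalksAcross_model₃ (c : B13.Consts) (hκ₁ : 0 ≤ c.κ₁) (j₀ : TPt d N') (ℓ : E →L[ℂ] ℂ) {R : ℝ} (hR : 0 < R)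
    (t : ℝ) {μP : ℝ} (tP : ℝ) {μA : ℝ} (lamA : ℝ) (hμP : 0 < μP) (hμA : 0 < μA)
    (hmA : 0 < mAcc c μA lamA ℓ R 0 1 ν) {η : ℝ} (hη : 0 < η) :
    UniformWalksAcross (modelFamily d N' c hκ₁ j₀ ℓ hR t μP tP hμA hmA) (qModel c ℓ R t tP μP μA lamA η ν) :=
  fun s _ => ⟨inferInstanceAs (Fintype (UT fun i => s.N i + 1)), inferInstanceAs (DecidableEq (UT fun i => s.N i + 1)),
    termWalks_model₃ (Nf := fun i => s.N i + 1) c hκ₁ s.hX j₀ ℓ hR t tP hμP hμA hmA hη⟩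

/-- **NODE O's BINDER OF RECORD FOR THE MODEL FAMILY**: `ExistsUniformAcrossSmall (modelFamily …) α R_σ0 θ₀`
(`B13TermWalkDataOneTorus` :353) — by `NodeOLettersOfWalksAcross.acrossSmall_of_walks_std` with the standard rate book, the volume
rate chosen as `η := etaMax` BEFORE the volume constant `c_V := c_V(η)` (the ORDER; `etaMax_qModel_indep`), under: the
torus-independent smallness `m_P, m_A > 0`; `0 ≤ α < R`; `R_σ0 ≤ 0`; and `θ₀ ≥ 4K̄ + 4` — the far-ness source read at the model's
`R_σ = 0` (its σ-region TOUCHES the rows, so no gain `e^{−εR_σ}` is available and the threshold becomes a largeness condition on `θ₀`,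
which then also covers the analyticity-space source `α ≤ θ₀R/(4K̄+4)` since `α < R`; for Bałaban's family `R_σ ≍ M` does that work).  A MODEL:
non-vacuity of the binder's shape across a genuine infinite family with one package, nothing about Bałaban's kernels.
[cite: Balaban1988RG2Cluster, (1.11) p.5, p.13, p.15, (2.16) p.16; Balaban1985BackgroundPropagators, Thm 3.10 p.416] -/
theorem acrossSmall_model₃ (c : B13.Consts) (hκ₁ : 0 ≤ c.κ₁) (j₀ : TPt d N') (ℓ : E →L[ℂ] ℂ) {R : ℝ} (hR : 0 < R)
    (t : ℝ) {μP tP μA lamA : ℝ} (hμP : 0 < μP) (hμA : 0 < μA) (hmP : 0 < mAcc c μP tP ℓ R 1 (ν + ν) ν)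
    (hmA : 0 < mAcc c μA lamA ℓ R 0 1 ν) {α Rσ₀ θ₀ : ℝ} (hα : 0 ≤ α) (hαR : α < R) (hRσ₀ : Rσ₀ ≤ 0)
    (hθ₀ : 4 * (qModel c ℓ R t tP μP μA lamA ((qModel c ℓ R t tP μP μA lamA 1 ν).etaMax) ν).Kbar + 4 ≤ θ₀) :
    ExistsUniformAcrossSmall (modelFamily d N' c hκ₁ j₀ ℓ hR t μP tP hμA hmA) α Rσ₀ θ₀ := by
  -- the ORDER: η⋆ := etaMax of the package (independent of its (η, c_V) fields), then c_V := c_V(η⋆)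
  set η := (qModel c ℓ R t tP μP μA lamA 1 ν).etaMax with hηdef
  have hq₁ := qModel_admissible (ν := ν) c ℓ hR t tP hμP hμA lamA one_pos hmP hmA
  have hp₁ := qModel_positiveRates (ν := ν) c ℓ R t tP μP μA lamA 1
  have hηpos : 0 < η := by
    rw [hηdef]
    exact lt_min (by have := WalkPackage.mu_pos hq₁ hp₁; positivity) (by have := WalkPackage.rhoE_pos hp₁; positivity)
  have hq := qModel_admissible (ν := ν) c ℓ hR t tP hμP hμA lamA hηpos hmP hmA
  have hp := qModel_positiveRates (ν := ν) c ℓ R t tP μP μA lamA η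
  have hηle : (qModel c ℓ R t tP μP μA lamA η ν).η ≤ (qModel c ℓ R t tP μP μA lamA η ν).etaMax :=
    le_of_eq (etaMax_qModel_indep c ℓ R t tP μP μA lamA η 1)
  have hK : 0 ≤ (qModel c ℓ R t tP μP μA lamA η ν).Kbar := WalkPackage.Kbar_nonneg hq
  have hθpos : 0 < θ₀ := by linarith
  have hpos := (qModel c ℓ R t tP μP μA lamA η ν).stdRates_pos hq hp hηle
  -- at `θ₀ ≥ 4K̄ + 4` the analyticity-space threshold `α ≤ θ₀R/(4K̄+4)` follows from `α < R`
  have hαsmall : α ≤ θ₀ * R / (4 * (qModel c ℓ R t tP μP μA lamA η ν).Kbar + 4) := by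
    rw [le_div_iff₀ (by positivity)]
    nlinarith [hR.le, hαR.le]
  refine acrossSmall_of_walks_std (uniformWalksAcross_model₃ c hκ₁ j₀ ℓ hR t tP lamA hμP hμA hmA hηpos) hq hp hηle hθpos hα hαR
    hRσ₀ hαsmall ?_
  -- far-ness threshold at `R_σ = 0`: `log((4K̄+4)/θ₀) ≤ 0`
  show Real.log ((4 * (qModel c ℓ R t tP μP μA lamA η ν).Kbar + 4) / θ₀) /
      ((qModel c ℓ R t tP μP μA lamA η ν).mu / 4 - (qModel c ℓ R t tP μP μA lamA η ν).kapCStar) ≤ 0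
  have hden : 0 < (qModel c ℓ R t tP μP μA lamA η ν).mu / 4 - (qModel c ℓ R t tP μP μA lamA η ν).kapCStar := by
    have h := hpos.2.1
    rw [hpos.2.2] at h
    exact sub_pos.2 h
  have hlog : Real.log ((4 * (qModel c ℓ R t tP μP μA lamA η ν).Kbar + 4) / θ₀) ≤ 0 :=
    Real.log_nonpos (by positivity) ((div_le_one hθpos).2 hθ₀)
  exact div_nonpos_of_nonpos_of_nonneg hlog hden.le

end Family

end Literature.MathematicalPhysics.QuantumFieldTheory.Balaban1983to89.NodeOLettersOfWalksAcrossWitness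

end
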